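import Summits.AtomisticToContinuum.FouriersLaw.Theses.HonestZwanzig

/-!
# `OrthogonalOhm` (crux `stmt-AtomisticToContinuum-12693`, route `HonestZwanzig`): load-bearing structure

Support file of the crux disprover (cdisprove seat, cycle 1), `sorry`-free, no definitions, no named
facts; nothing here asserts a route statement.  Contents:

* `lengthTwo_redundant` — the side condition `2 ≤ N` of the crux is NOT load-bearing: the crux implies
  its own strengthening over all lengths (a chain of length `≤ 1` has no bond, `J ≡ 0`, every contact
  response is the constant `0`; `0 ≤ C` is forced by the bond of the `N = 2` instance).
* `schur_eq_lap_of_not_isUnit_det` — the junk branch of the route's Schur gadget: if the energy Gram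
  matrix `[lap(e_x,e_y)]` is singular, `Matrix.inv` returns `0` and `schur = lap` (the UNprojected pairing);
  excluded for `s > 0` by route item `FeshbachIdentities` (iv), which is therefore consumed by every limit
  statement of the route.
* `backflow_nonneg`, `schur_self_ge_lap_self`, `backflow_sign_needs_reversal` — the inequality
  `schur_s(J,J) ≥ lap_s(J,J)` quoted in the crux docstring holds for a positive definite Gram matrix EXACTLY
  because the second-slot couplings are the negatives of the first-slot ones (time reversal, opposite
  parities: `FeshbachIdentities` (ii)); a `1 × 1` witness shows the antisymmetry is load-bearing.
* `conductance_le_of_rowConstancy_backflow_bound` — the precise sense in which the crux's boundedness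
  clause contains `HasBoundedResponse`: Kirchhoff-flat full responses `lap₀(j_b,J) = κ` (W1), backflow
  `≥ 0`, and `|ρ_b| ≤ C` for every bond force `κ ≤ C` (`κ = T²D_N`).
* `bulkRegression_of_rho_and_clamped` — converse bookkeeping of line `Sketch`
  (`Cruxes/OrthogonalOhm/Lines/Sketch.lean`): modulo the regression identity R1 and the clamped contact
  decay R3, stub R2 (`BulkRegressionOhm`) follows from the crux, so the line's surplus over the crux is
  exactly R3.

## References

* R. Zwanzig, Nonequilibrium Statistical Mechanics (OUP 2001), Ch. 8 (projection operators, Schur form).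
* A. Kundu, A. Dhar, O. Narayan, J. Stat. Mech. (2009) L03001, arXiv:0809.4543 (open-chain Green–Kubo).
-/

noncomputable section

open MeasureTheory Filter Topology Matrix

namespace Summit.AtomisticToContinuum.FouriersLaw.Theorems.OrthogonalOhm.Negative

open Summit.AtomisticToContinuum.FouriersLaw.Theses.HonestZwanzig (OrthogonalOhm)

/-! ## The side condition `2 ≤ N` -/

/-- Chains of length `N ≤ 1` have no bond: every `bondCurrent N i` of `pinnedChain` vanishes
identically. [folklore] -/
theorem bondCurrent_eq_zero_of_lt_two (ω₂ lam β γ : ℝ) {N : ℕ} (hN : N < 2) (i : Fin N)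
    (z : Literature.MathematicalPhysics.KineticTheory.HeatConduction.PhaseSpace N) :
    (Literature.MathematicalPhysics.KineticTheory.HeatConduction.pinnedChain ω₂ lam β γ).bondCurrent N i z
      = 0 := by
  unfold Literature.MathematicalPhysics.KineticTheory.HeatConduction.OscillatorChain.bondCurrent
  refine Finset.sum_eq_zero fun j _ => ?_
  have hj := j.isLt
  have hi := i.isLt
  rw [if_neg (by omega)]

/-- **`2 ≤ N` is not load-bearing**: `OrthogonalOhm` implies the same statement over ALL lengths `N`
(identical `let`-gadgets, the guard `2 ≤ N →` deleted).  For `N ≤ 1` there is no bond, so the bond clause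
is empty, `J ≡ 0`, `corr(·,J) ≡ 0`, `lap_s(·,J) = 0`, `schur_s(p_b²,J) = 0`, and the contact responses are
the constant `0`, bounded by `C` because `0 ≤ C` is forced by the bond `b = 0` of the `N = 2` instance.
(The converse implication is trivial.) [folklore] -/
theorem lengthTwo_redundant (h : OrthogonalOhm) :
    ∀ ω₂ lam β γ : ℝ, 0 < ω₂ → 0 < lam → 0 < β → 0 < γ → ∀ T : ℝ, 0 < T → ∃ k C : ℝ, ∀ ε : ℝ, 0 < ε → ∃ R : ℕ, ∀ N : ℕ, let P := Literature.MathematicalPhysics.KineticTheory.HeatConduction.pinnedChain ω₂ lam β γ; let X := Literature.MathematicalPhysics.KineticTheory.HeatConduction.PhaseSpace N; let μ : MeasureTheory.Measure X := P.gibbsMeasure N T; let corr : (X → ℝ) → (X → ℝ) → ℝ → ℝ := fun f g t => (∫ z, f z * (∫ y, g y ∂(P.transitionKernel N T T t.toNNReal z)) ∂μ) - (∫ z, f z ∂μ) * (∫ z, g z ∂μ); let lap : ℝ → (X → ℝ) → (X → ℝ) → ℝ := fun s f g => ∫ t in Set.Ioi (0 : ℝ), Real.exp (-(s * t)) * corr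 f g t; let e : Fin N → X → ℝ := fun x z => z.2 x ^ 2 / 2 + P.U (z.1 x) + ∑ j : Fin N, ((if j.val = x.val + 1 then P.V (z.1 j - z.1 x) / 2 else 0) + (if x.val = j.val + 1 then P.V (z.1 x - z.1 j) / 2 else 0)); let G : ℝ → Matrix (Fin N) (Fin N) ℝ := fun s => Matrix.of fun x y => lap s (e x) (e y); let schur : ℝ → (X → ℝ) → (X → ℝ) → ℝ := fun s f g => lap s f g - ∑ x : Fin N, ∑ y : Fin N, lap s f (e x) * (G s)⁻¹ x y * lap s (e y) g; let J : X → ℝ := fun z => ∑ i : Fin N, P.bondCurrent N i z; (∀ b : Fin N, b.val + 1 < N → ∃ ρ : ℝ, Filter.Tendsto (fun s => schur s (P.bondCurrent N b) J) (nhdsWithin (0 : ℝ) (Set.Ioi 0)) (nhds ρ) ∧ |ρ| ≤ C ∧ (R ≤ b.val → b.val + 2 + R ≤ N → |ρ - k| ≤ ε)) ∧ (∀ b : Fin N, (b.val = 0 ∨ b.val = N - 1) → ∃ w : ℝ, Filter.Tendsto (fun s => schur s (fun z => z.2 b ^ 2) J) (nhdsWithin (0 : ℝ) (Set.Ioi 0))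 (nhds w) ∧ |w| ≤ C) := by
  intro ω₂ lam β γ hω hl hβ hγ T hT
  obtain ⟨k, C, hkC⟩ := h ω₂ lam β γ hω hl hβ hγ T hT
  refine ⟨k, C, fun ε hε => ?_⟩
  obtain ⟨R, hR⟩ := hkC ε hε
  have hC : 0 ≤ C := by
    obtain ⟨ρ, -, hρ, -⟩ := (hR 2 le_rfl).1 ⟨0, by norm_num⟩ (by norm_num)
    exact (abs_nonneg ρ).trans hρ
  refine ⟨R, fun N => ?_⟩
  by_cases hN : 2 ≤ N
  · exact hR N hN
  · have hN' : N < 2 := by omega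
    intro P X μ corr lap e G schur J
    have hJ0 : ∀ z, J z = 0 := fun z =>
      Finset.sum_eq_zero fun i _ => bondCurrent_eq_zero_of_lt_two ω₂ lam β γ hN' i z
    have hcorr : ∀ (g : X → ℝ) (t : ℝ), corr g J t = 0 := by
      intro g t
      show (∫ z, g z * (∫ y, J y ∂(P.transitionKernel N T T t.toNNReal z)) ∂μ)
          - (∫ z, g z ∂μ) * (∫ z, J z ∂μ) = 0
      simp [hJ0]
    have hlap : ∀ (s : ℝ) (g : X → ℝ), lap s g J = 0 := by
      intro s g
      show (∫ t in Set.Ioi (0 : ℝ), Real.exp (-(s * t)) * corr g J t) = 0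
      simp [hcorr]
    have hschur : ∀ (s : ℝ) (g : X → ℝ), schur s g J = 0 := by
      intro s g
      show lap s g J - ∑ x : Fin N, ∑ y : Fin N, lap s g (e x) * (G s)⁻¹ x y * lap s (e y) J = 0
      simp [hlap]
    refine ⟨fun b hb => ?_, fun b _ => ⟨0, ?_, by simpa using hC⟩⟩
    · exact absurd hb (by have := b.isLt; omega)
    · simp only [hschur]
      exact tendsto_const_nhds

/-! ## The Schur gadget `schur = lap − lap(·,e) [lap(e,e)]⁻¹ lap(e,·)` -/

section gadget

variable {X : Type*} {N : ℕ}

/-- **Junk branch.**  If the Gram matrix `[lap(e_x, e_y)]` is singular, Mathlib's `Matrix.inv` is `0` and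
the route's "Schur complement" collapses to the unprojected pairing `lap f g`.  For `s > 0` this is excluded
by route item `FeshbachIdentities` (iv) (`G(s)` positive definite), which every `Tendsto (fun s => schur s …)`
clause of the route therefore consumes; the crux itself never evaluates `G(0)⁻¹`. [folklore] -/
theorem schur_eq_lap_of_not_isUnit_det (lap : (X → ℝ) → (X → ℝ) → ℝ) (e : Fin N → X → ℝ)
    (hG : ¬ IsUnit (Matrix.of fun x y => lap (e x) (e y)).det) (f g : X → ℝ) :
    lap f g - ∑ x : Fin N, ∑ y : Fin N,
        lap f (e x) * (Matrix.of fun x y => lap (e x) (e y))⁻¹ x y * lap (e y) g = lap f g := by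
  rw [Matrix.nonsing_inv_apply_not_isUnit _ hG]
  simp

/-- **Backflow is non-negative** for a positive definite real Gram matrix: `Λᵀ G⁻¹ Λ ≥ 0`
(think `Λ_x = lap_s(J, e_x)`). [folklore] -/
theorem backflow_nonneg (G : Matrix (Fin N) (Fin N) ℝ) (hG : G.PosDef) (Λ : Fin N → ℝ) :
    0 ≤ ∑ x : Fin N, ∑ y : Fin N, Λ x * G⁻¹ x y * Λ y := by
  have h := hG.inv.posSemidef.dotProduct_mulVec_nonneg Λ
  have hsum : ∑ x : Fin N, ∑ y : Fin N, Λ x * G⁻¹ x y * Λ y = Λ ⬝ᵥ (G⁻¹ *ᵥ Λ) := by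
    simp only [dotProduct, Matrix.mulVec, Finset.mul_sum, mul_assoc]
  rw [hsum]
  simpa using h

/-- **`schur(J,J) ≥ lap(J,J)` under time-reversal antisymmetry**: if the second-slot couplings are the
negatives of the first-slot ones (`lap_s(e_x, J) = −lap_s(J, e_x)`, opposite parities under momentum
reversal — route item `FeshbachIdentities` (ii)) and the Gram matrix is positive definite, the Schur
correction is `≥ 0`; summed over bonds this is `Σ_b ρ_b ≥ (N−1)T²D_N` of the crux docstring. [folklore] -/
theorem schur_self_ge_lap_self (G : Matrix (Fin N) (Fin N) ℝ) (hG : G.PosDef) (a : ℝ) (Λ Λ' : Fin N → ℝ)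
    (hrev : ∀ x, Λ' x = -Λ x) :
    a ≤ a - ∑ x : Fin N, ∑ y : Fin N, Λ x * G⁻¹ x y * Λ' y := by
  have h := backflow_nonneg G hG Λ
  have : ∑ x : Fin N, ∑ y : Fin N, Λ x * G⁻¹ x y * Λ' y
      = -∑ x : Fin N, ∑ y : Fin N, Λ x * G⁻¹ x y * Λ y := by
    simp only [hrev, mul_neg, Finset.sum_neg_distrib]
  linarith

/-- **Time reversal is load-bearing** for that inequality: without `Λ' = −Λ` the Schur correction has no
sign (`1 × 1` witness `G = 1`, `Λ = Λ' = 1`: `schur = lap − 1 < lap`). [folklore] -/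
theorem backflow_sign_needs_reversal :
    ¬ ∀ (a Λ Λ' g : ℝ), 0 < g → a ≤ a - Λ * g⁻¹ * Λ' := by
  intro h
  have := h 0 1 1 1 one_pos
  norm_num at this

/-- **What the boundedness clause contains.**  At one length with `n ≥ 1` bonds: Kirchhoff-flat full DC
responses `lap₀(j_b, J) = κ` (W1 of the zero-frequency Ward dictionary, `κ = T²D_N`), non-negative total
backflow `Σ_b (ρ_b − lap₀(j_b, J)) ≥ 0` (`schur_self_ge_lap_self` summed), and the crux's `|ρ_b| ≤ C` for
every bond give `κ ≤ C`.  With `κ = T²D_N` unbounded (harmonic corner) this is the contradiction behind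
"false without anharmonicity"; with the crux it is `sup_N T²D_N ≤ C` (HasBoundedResponse level).
[cite: KunduDharNarayan2009, p. 3] -/
theorem conductance_le_of_rowConstancy_backflow_bound {n : ℕ} (hn : 0 < n) (κ C : ℝ)
    (ρ lapJ : Fin n → ℝ) (hW1 : ∀ b, lapJ b = κ) (hback : 0 ≤ ∑ b, (ρ b - lapJ b))
    (hC : ∀ b, |ρ b| ≤ C) : κ ≤ C := by
  have hsum : ∑ b : Fin n, (ρ b - lapJ b) = (∑ b : Fin n, ρ b) - n * κ := by
    simp only [Finset.sum_sub_distrib, hW1, Finset.sum_const, Finset.card_univ, Fintype.card_fin,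
      nsmul_eq_mul]
  have hρ : ∑ b : Fin n, ρ b ≤ n * C := by
    calc ∑ b : Fin n, ρ b ≤ ∑ _b : Fin n, C := Finset.sum_le_sum fun b _ => (le_abs_self _).trans (hC b)
      _ = n * C := by simp
  have hn' : (0 : ℝ) < n := by exact_mod_cast hn
  nlinarith

end gadget

/-! ## Line `Sketch`: the surplus over the crux is stub R3 -/

/-- **Converse bookkeeping of line `Sketch`.**  From the regression identity (stub R1) at origin `a = b`,
`ρ = r − bγω₀ + Mγω₁` (`M = N−1−b`), one has `|r − k| ≤ |ρ − k| + γ(b|ω₀| + M|ω₁|)`: given the crux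
(`|ρ_b − k| ≤ ε`, `|ρ_b| ≤ C`) and stub R3 (`b|ω₀|, M|ω₁| ≤ C₃`, `≤ ε` in the bulk), stub R2
(`BulkRegressionOhm`) follows with the same `k` — so R2 cannot fail unless the crux or R3 does. [folklore] -/
theorem bulkRegression_of_rho_and_clamped (ρ r k γ ω₀ ω₁ b M : ℝ) (hγ : 0 ≤ γ) (hb : 0 ≤ b) (hM : 0 ≤ M)
    (hR1 : ρ = r - b * γ * ω₀ + M * γ * ω₁) :
    |r - k| ≤ |ρ - k| + γ * (b * |ω₀| + M * |ω₁|) := by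
  have hr : r - k = (ρ - k) + b * γ * ω₀ - M * γ * ω₁ := by rw [hR1]; ring
  rw [hr]
  have h1 : |b * γ * ω₀| = γ * (b * |ω₀|) := by
    rw [abs_mul, abs_mul, abs_of_nonneg hb, abs_of_nonneg hγ]; ring
  have h2 : |M * γ * ω₁| = γ * (M * |ω₁|) := by
    rw [abs_mul, abs_mul, abs_of_nonneg hM, abs_of_nonneg hγ]; ring
  calc |ρ - k + b * γ * ω₀ - M * γ * ω₁|
      ≤ |ρ - k + b * γ * ω₀| + |M * γ * ω₁| := abs_sub _ _
    _ ≤ |ρ - k| + |b * γ * ω₀| + |M * γ * ω₁| := by gcongr; exact abs_add_le _ _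
    _ = |ρ - k| + γ * (b * |ω₀| + M * |ω₁|) := by rw [h1, h2]; ring

end Summit.AtomisticToContinuum.FouriersLaw.Theorems.OrthogonalOhm.Negative
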